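import Summits.ABC.IUTFork.Cor312NaturalScaledSetting
import HarnessLib

/-!
# [IUTchIII] Cor. 3.12 — the honestly scaled natural bed P♮ˢ(e), II: volumes, typed Theorem 3.11, regions, hull, the Statement

PROOF-ONLY companion (0 `def`s, no `Prop` fact) of `Cor312NaturalScaledSetting` (the model data of P♮ˢ(e), seat abc-iut-rp-m4 gen 3,
IUT REPAIR branch rung LADDER-ABC:A2.RP, engine E7 of row RP-M51 `Repair/CandMochizuki41`). TAKES NO SIDE on [IUTchIII] Cor. 3.12 or on
any author; a model of READING PREDICATES is a consistency witness; toy carriers; typed ≠ proved.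

RESULTS (ns `Summit.ABC.IUTFork.Cor312Vol.NaturalScaledWitness`), for EVERY profile `e : Label → ℕ`: §7 elementary geometry of the two halves
`posK`, `negK` of the valuation ball `ballR (e j)`; §8 the volume `scVol e`: values (`{0} ↦ −e(j)−2`, halves `↦ −e(j)−1`, `ballR (e j) ↦ −e(j)`,
shell `ball ↦ 0` AT EVERY LABEL, `univ ↦ 1`), monotone, sign-invariant, hence Step (x) `LogvolInvariant` (`scData_logvolInvariant`) with a
group that MOVES the Θ-region; §9 the typed Theorem 3.11 (i) ∧ (ii) ∧ (iii) (`scFull_statement`); §10 pilots of exponent `1`, Θ-region `posK`,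
q-region `negK`, possible images EXACTLY `{posK, negK}`, hull `ballR (e j)`; §11 volumes `sc_thetaLocal = −e(j)`, `sc_qLocal = −e(j) − 1`, own
Θ-volume `sc_logvol_thetaRegion = −e(j) − 1`, `−|log(Θ)| = PN(−e)`, `−|log(q)| = PN(−e) − 1`, the Statement STRICT (`sc_statement_strict`),
`|log(q)| > 0`, all bridge hypotheses. Pins, `S`, the readings: part III `Cor312NaturalScaledWitness`. Nothing here grades any row.
-/

noncomputable section

open Set

namespace Summit.ABC.IUTFork.Cor312Vol

namespace NaturalScaledWitness

open Thm311 Cor312 Cor312.Checks Cor312.IdentifiedNonVacuity Cor312.ScaledCopies NaiveWitness PinnedWitness NaturalWitness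
  Literature.IUT.LogThetaLattice

variable (e : toyIndex.Label → ℕ)

/-! ## 7. Elementary geometry of the two halves on the packet line -/

/-- The point of coordinate `2^{−e(j)}` lies in `posK`, not in `negK`, and is not `0`. [folklore] -/
theorem pt_mem (j : toyIndex.Label) (vQ : toyIndex.VQ) :
    ScaledCopies.pt (e j) j vQ ∈ posK e j vQ ∧ ScaledCopies.pt (e j) j vQ ∉ negK e j vQ ∧ ScaledCopies.pt (e j) j vQ ≠ 0 := by
  refine ⟨⟨by rw [ScaledCopies.line_pt]; exact (radius_pos _).le, by rw [ScaledCopies.line_pt]⟩, fun h => ?_, fun h => ?_⟩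
  · have h2 := h.2; rw [ScaledCopies.line_pt] at h2; exact absurd h2 (not_le.2 (radius_pos _))
  · exact line_pt_ne_zero (e j) j vQ (by rw [h, map_zero])

/-- The point of coordinate `−2^{−e(j)}` lies in `negK` and in `ballR (e j)`, not in `posK`. [folklore] -/
theorem npt_mem (j : toyIndex.Label) (vQ : toyIndex.VQ) :
    lpt j vQ (-radius (e j)) ∈ negK e j vQ ∧ lpt j vQ (-radius (e j)) ∈ ballR (e j) j vQ ∧ lpt j vQ (-radius (e j)) ∉ posK e j vQ := by
  have hr := radius_pos (e j)
  refine ⟨⟨by rw [line_lpt], by rw [line_lpt]; linarith⟩, ?_, fun h => ?_⟩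
  · show |line j vQ (lpt j vQ (-radius (e j)))| ≤ radius (e j)
    rw [line_lpt, abs_neg, abs_of_pos hr]
  · have h1 := h.1; rw [line_lpt] at h1; linarith

/-- Non-inclusions among the hull-sets. [folklore] -/
theorem scHul_not_subset (j : toyIndex.Label) (vQ : toyIndex.VQ) :
    ¬ posK e j vQ ⊆ {0} ∧ ¬ negK e j vQ ⊆ {0} ∧ ¬ posK e j vQ ⊆ negK e j vQ ∧ ¬ negK e j vQ ⊆ posK e j vQ ∧
      ¬ ballR (e j) j vQ ⊆ posK e j vQ ∧ ¬ ballR (e j) j vQ ⊆ negK e j vQ ∧ ¬ (Set.univ : Set (signShells.Packet j vQ)) ⊆ ball j vQ := by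
  obtain ⟨hp1, hn1, h10⟩ := pt_mem e j vQ
  obtain ⟨hn2, hb2, hp2⟩ := npt_mem e j vQ
  refine ⟨fun h => h10 (h hp1), fun h => ?_, fun h => hn1 (h hp1), fun h => hp2 (h hn2), fun h => hp2 (h hb2),
    fun h => hn1 (h (posK_subset_ballR e j vQ hp1)), fun h => ball_ne_univ j vQ (Set.eq_univ_of_univ_subset h)⟩
  have h0 : lpt j vQ (-radius (e j)) = 0 := h hn2
  have h1 := congrArg (line j vQ) h0
  rw [line_lpt, map_zero, neg_eq_zero] at h1
  exact (radius_pos (e j)).ne' h1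

/-- The shell lies in the valuation ball of depth `e(j)` iff that depth is `0`. [folklore] -/
theorem ball_subset_ballR_iff (j : toyIndex.Label) (vQ : toyIndex.VQ) : ball j vQ ⊆ ballR (e j) j vQ ↔ e j = 0 := by
  rw [← ballR_zero, ballR_subset_ballR_iff]; exact Nat.le_zero

/-! ## 8. The log-volume: values, monotonicity, sign-invariance -/

/-- The volumes of the hull-sets: `−e(j)−2, −e(j)−1, −e(j)−1, −e(j)`, the shell `0`, everything `1`. [folklore] -/
theorem scVol_values (j : toyIndex.Label) (vQ : toyIndex.VQ) :
    scVol e j vQ {0} = -(e j : ℝ) - 2 ∧ scVol e j vQ (posK e j vQ) = -(e j : ℝ) - 1 ∧ scVol e j vQ (negK e j vQ) = -(e j : ℝ) - 1 ∧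
      scVol e j vQ (ballR (e j) j vQ) = -(e j : ℝ) ∧ scVol e j vQ (ball j vQ) = 0 ∧ scVol e j vQ Set.univ = 1 := by
  obtain ⟨h1, h2, h3, h4, h5, h6, h7⟩ := scHul_not_subset e j vQ
  have hS0 : ¬ ballR (e j) j vQ ⊆ {0} := fun h => h1 ((posK_subset_ballR e j vQ).trans h)
  have hB0 : ¬ ball j vQ ⊆ {0} := fun h => hS0 ((ballR_subset_ball _ j vQ).trans h)
  have hBh : ¬ (ball j vQ ⊆ posK e j vQ ∨ ball j vQ ⊆ negK e j vQ) := fun h =>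
    h.elim (fun h' => h5 ((ballR_subset_ball _ j vQ).trans h')) fun h' => h6 ((ballR_subset_ball _ j vQ).trans h')
  unfold scVol
  refine ⟨by rw [if_pos subset_rfl], by rw [if_neg h1, if_pos (Or.inl subset_rfl)], by rw [if_neg h2, if_pos (Or.inr subset_rfl)],
    by rw [if_neg hS0, if_neg (fun h => h.elim h5 h6), if_pos subset_rfl], ?_, ?_⟩
  · rw [if_neg hB0, if_neg hBh]
    by_cases hB : ball j vQ ⊆ ballR (e j) j vQ
    · rw [if_pos hB, (ball_subset_ballR_iff e j vQ).1 hB, Nat.cast_zero, neg_zero]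
    · rw [if_neg hB, if_pos subset_rfl]
  · rw [if_neg (fun h => hB0 ((Set.subset_univ _).trans h)),
      if_neg (fun h => hBh (h.imp (Set.subset_univ _).trans (Set.subset_univ _).trans)),
      if_neg (univ_not_subset_ballR _ j vQ), if_neg h7]

/-- The shell has log-volume `0` at EVERY label (print's normalisation, [IUTchIII] Prop. 3.9 (i)–(ii)). [folklore] -/
theorem scVol_ball (j : toyIndex.Label) (vQ : toyIndex.VQ) : scVol e j vQ (ball j vQ) = 0 := (scVol_values e j vQ).2.2.2.2.1

/-- The log-volume is MONOTONE on all regions. [folklore] -/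
theorem scVol_mono {j : toyIndex.Label} {vQ : toyIndex.VQ} {A B : Set (signShells.Packet j vQ)} (hAB : A ⊆ B) :
    scVol e j vQ A ≤ scVol e j vQ B := by
  have he : (0 : ℝ) ≤ (e j : ℝ) := Nat.cast_nonneg _
  unfold scVol
  by_cases hB0 : B ⊆ {0}
  · rw [if_pos (hAB.trans hB0), if_pos hB0]
  rw [if_neg hB0]
  by_cases hA0 : A ⊆ {0}
  · rw [if_pos hA0]; split_ifs <;> linarith
  rw [if_neg hA0]
  by_cases hBh : B ⊆ posK e j vQ ∨ B ⊆ negK e j vQ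
  · rw [if_pos hBh, if_pos (hBh.imp hAB.trans hAB.trans)]
  rw [if_neg hBh]
  by_cases hAh : A ⊆ posK e j vQ ∨ A ⊆ negK e j vQ
  · rw [if_pos hAh]; split_ifs <;> linarith
  rw [if_neg hAh]
  by_cases hBs : B ⊆ ballR (e j) j vQ
  · rw [if_pos hBs, if_pos (hAB.trans hBs)]
  rw [if_neg hBs]
  by_cases hAs : A ⊆ ballR (e j) j vQ
  · rw [if_pos hAs]; split_ifs <;> linarith
  rw [if_neg hAs]
  by_cases hBb : B ⊆ ball j vQ
  · rw [if_pos hBb, if_pos (hAB.trans hBb)]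
  rw [if_neg hBb]
  split_ifs <;> norm_num

/-- Reflection swaps the two halves and fixes every valuation ball. [folklore] -/
theorem negSet_scHul (j : toyIndex.Label) (vQ : toyIndex.VQ) :
    negSet (posK e j vQ) = negK e j vQ ∧ negSet (negK e j vQ) = posK e j vQ ∧ ∀ k : ℕ, negSet (ballR k j vQ) = ballR k j vQ := by
  refine ⟨?_, ?_, fun k => ?_⟩
  · ext y
    simp only [negSet, posK, negK, Set.mem_setOf_eq, map_neg]
    constructor <;> rintro ⟨h1, h2⟩ <;> constructor <;> linarith
  · ext y
    simp only [negSet, posK, negK, Set.mem_setOf_eq, map_neg]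
    constructor <;> rintro ⟨h1, h2⟩ <;> constructor <;> linarith
  · ext y
    simp only [negSet, ballR, Set.mem_setOf_eq, map_neg, abs_neg]

/-- Regions with the same position relative to the hull-sets have the same log-volume. [folklore] -/
theorem scVol_eq_of_iff {j : toyIndex.Label} {vQ : toyIndex.VQ} {A B : Set (signShells.Packet j vQ)} (h0 : A ⊆ {0} ↔ B ⊆ {0})
    (hh : (A ⊆ posK e j vQ ∨ A ⊆ negK e j vQ) ↔ (B ⊆ posK e j vQ ∨ B ⊆ negK e j vQ))
    (hs : A ⊆ ballR (e j) j vQ ↔ B ⊆ ballR (e j) j vQ) (hb : A ⊆ ball j vQ ↔ B ⊆ ball j vQ) : scVol e j vQ A = scVol e j vQ B := by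
  unfold scVol
  by_cases a0 : A ⊆ {0}
  · rw [if_pos a0, if_pos (h0.1 a0)]
  rw [if_neg a0, if_neg (fun b0 => a0 (h0.2 b0))]
  by_cases ah : A ⊆ posK e j vQ ∨ A ⊆ negK e j vQ
  · rw [if_pos ah, if_pos (hh.1 ah)]
  rw [if_neg ah, if_neg (fun bh => ah (hh.2 bh))]
  by_cases as : A ⊆ ballR (e j) j vQ
  · rw [if_pos as, if_pos (hs.1 as)]
  rw [if_neg as, if_neg (fun bs => as (hs.2 bs))]
  by_cases ab : A ⊆ ball j vQ
  · rw [if_pos ab, if_pos (hb.1 ab)]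
  · rw [if_neg ab, if_neg (fun bb => ab (hb.2 bb))]

/-- The log-volume is invariant under reflection. [folklore] -/
theorem scVol_negSet {j : toyIndex.Label} {vQ : toyIndex.VQ} (A : Set (signShells.Packet j vQ)) :
    scVol e j vQ (negSet A) = scVol e j vQ A := by
  obtain ⟨hP, hN, hR⟩ := negSet_scHul e j vQ
  obtain ⟨h0, -, -, hB⟩ := negSet_hul j vQ
  refine scVol_eq_of_iff e (by rw [negSet_subset_iff, h0]) ?_ (by rw [negSet_subset_iff, hR]) (by rw [negSet_subset_iff, hB])
  rw [negSet_subset_iff, negSet_subset_iff, hP, hN]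
  exact Or.comm

/-- **The log-volume is invariant under every family acting by signs** — in particular under ⟨(Ind1)∪(Ind2)⟩, although that group MOVES the
Θ-region `posK`: Step (x) of the printed proof holds in P♮ˢ(e) non-trivially. [folklore] -/
theorem scVol_image_of_actsBySigns {Φ : signShells.PacketAut} (h : ActsBySigns Φ) (j : toyIndex.Label) (vQ : toyIndex.VQ)
    (A : Set (signShells.Packet j vQ)) : scVol e j vQ (Φ j vQ '' A) = scVol e j vQ A := by
  rcases image_eq_or_of_actsBySigns h j vQ A with h' | h'
  · rw [h']
  · rw [h', scVol_negSet]

/-- `LogvolInvariant` of the data of P♮ˢ(e) (abc-iut-c312-1's named side condition of Step (x)), PROVED. [folklore] -/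
theorem scData_logvolInvariant : (scData e).LogvolInvariant := fun Φ hΦ j vQ A _ => by
  rcases hΦ with h1 | h2
  · exact scVol_image_of_actsBySigns e (actsBySigns_of_mem_Ind1Family h1) j vQ A
  · exact scVol_image_of_actsBySigns e (actsBySigns_of_mem_Ind2Family h2) j vQ A

/-! ## 9. The typed Theorem 3.11 (i) ∧ (ii) ∧ (iii) HOLDS for P♮ˢ(e) -/

/-- (i): the splitting monoid sits in the sub-packets; the degree `0` IS the global log-volume of the shell; the classes coincide. [folklore] -/
theorem sc_partI : (scFull e).PartI := by
  refine ⟨fun n v hv x _ j => ?_, fun n j k => ⟨fun vQ => trivial, Set.toFinite _, ?_⟩, fun _ _ => rfl⟩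
  · show x j ∈ signShells.SubPacket j.1 v
    rw [subPacket_eq_top]; trivial
  · show (0 : ℝ) = ∑ᶠ vQ : toyIndex.VQ, scVol e j.1 vQ (ball j.1 vQ)
    rw [finsum_unique]
    exact (scVol_ball e j.1 _).symm

/-- (ii): identity Kummer transport ((a), (b), (c) by `rfl`; (Ind3) = `ball ⊆ ball`; no archimedean place). [folklore] -/
theorem sc_partII : (scFull e).toLatticeSituation.PartII := fun _ =>
  (Column.partII_iff _ _).2
    ⟨fun _ _ _ _ _ => ⟨trivial, rfl⟩, fun _ _ _ => rfl, fun _ _ => rfl, fun _ _ _ _ _ => subset_rfl, fun _ _ _ h => absurd trivial h⟩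

/-- (iii): abc-iut-w5-d247's `naiveLink`. [folklore] -/
theorem sc_partIII : (scFull e).PartIII := by
  refine ⟨naiveLink.partIIIa_holds, naiveLink.partIIIb_holds, ?_, fun n m => Thm311.PolyIsoCalc.stabilized_full _ _,
    (scFull e).evalCompatUpToInd_of_multiradialCompat (sc_partI e).2.2⟩
  refine naiveLink.partIIIc_of_full (fun _ => rfl) fun n m => ?_
  rintro _ ⟨a, rfl⟩
  show unitIso a ≪≫ unitIso ((-1) ^ m.natAbs) = unitIso ((-1) ^ m.natAbs) ≪≫ unitIso a
  rw [unitIso_trans, unitIso_trans, mul_comm]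

/-- **The typed Theorem 3.11 (i) ∧ (ii) ∧ (iii) HOLDS in P♮ˢ(e)**, for every profile `e`. [folklore] -/
theorem scFull_statement : (scFull e).Statement := ⟨sc_partI e, sc_partII e, sc_partIII e⟩

/-- `MultiradialCompat` (part of (i)). [folklore] -/
theorem sc_multiradialCompat : (scFull e).MultiradialCompat := (sc_partI e).2.2

/-- Thm. 3.11 (ii) (b) for the column of the setting. [folklore] -/
theorem sc_kummerB : ((scFull e).toLatticeSituation.col (scSetting e).n).KummerB ((scFull e).toLatticeSituation.D (scSetting e).n) :=
  (sc_partII e (scSetting e).n).2.1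

/-! ## 10. Pilots, regions, possible images, hull -/

/-- The pilots are the objects of exponent `1`. [folklore] -/
theorem sc_pilots : (scSetting e).thetaPilot = (1 : ℤ) ∧ (scSetting e).qPilot = (1 : ℤ) :=
  ⟨congrArg (Nat.cast : ℕ → ℤ)
    (expOf_eq_one_of_isGenerator_top (Classical.choose_spec ((scSetting e).split.exists_gen () (Set.mem_univ ())))), rfl⟩

/-- The Kummer image of the Θ-pilot at `(m, j, v_ℚ)` is `thetaRegionK e 1`. [folklore] -/
theorem sc_thetaRegion (m : ℤ) (j : toyIndex.Label) (vQ : toyIndex.VQ) : (scSetting e).thetaRegion m j vQ = thetaRegionK e 1 j vQ := by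
  unfold Setting.thetaRegion; rw [(sc_pilots e).1]; rfl

/-- The (Ind3)-enlarged Θ-region (no `m`-drift). [folklore] -/
theorem sc_thetaRegion3 (j : toyIndex.Label) (vQ : toyIndex.VQ) : (scSetting e).thetaRegion3 j vQ = thetaRegionK e 1 j vQ := by
  show (⋃ m : ℤ, (scSetting e).thetaRegion m j vQ) = _
  simp_rw [sc_thetaRegion]; exact Set.iUnion_const _

/-- The q-pilot image. [folklore] -/
theorem sc_qRegion (j : toyIndex.Label) (vQ : toyIndex.VQ) : (scSetting e).qRegion j vQ = qRegionK e 1 j vQ := rfl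

/-- On `𝔽_l^⋇`: Θ-region `posK`, q-region `negK`. [folklore] -/
theorem sc_regions_of_ne_zero {j : toyIndex.Label} (hj : j ≠ 0) (vQ : toyIndex.VQ) :
    (scSetting e).thetaRegion3 j vQ = posK e j vQ ∧ (scSetting e).qRegion j vQ = negK e j vQ := by
  rw [sc_thetaRegion3, sc_qRegion, thetaRegionK_one_of_ne_zero e hj, qRegionK_one_of_ne_zero e hj]
  exact ⟨rfl, rfl⟩

/-- `flipFamily` lies in the (Ind1)(Ind2)-group of the situation. [folklore] -/
theorem flipFamily_mem_indGroup_sc : flipFamily ∈ Setting.indGroup (scSituation e) :=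
  Subgroup.subset_closure (Or.inr flipFamily_mem_Ind2Family)

/-- `flipFamily` maps `posK` onto `negK`. [folklore] -/
theorem image_posK_flipFamily (j : toyIndex.Label) (vQ : toyIndex.VQ) : flipFamily j vQ '' posK e j vQ = negK e j vQ := by
  rw [← (negSet_scHul e j vQ).1]
  ext y
  simp only [Set.mem_image, negSet, Set.mem_setOf_eq]
  constructor
  · rintro ⟨x, hx, rfl⟩; rw [flipFamily_apply, neg_neg]; exact hx
  · intro hy; exact ⟨-y, hy, by rw [flipFamily_apply, neg_neg]⟩

/-- **The possible images at a label of `𝔽_l^⋇` are EXACTLY the two halves** (every element of ⟨(Ind1)∪(Ind2)⟩ acts by a sign; the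
identity gives `posK`, `flipFamily` gives `negK`). [folklore] -/
theorem sc_possibleImages {j : toyIndex.Label} (hj : j ≠ 0) (vQ : toyIndex.VQ) :
    (scSetting e).possibleImages j vQ = {posK e j vQ, negK e j vQ} := by
  ext U
  rw [Setting.possibleImages, (sc_regions_of_ne_zero e hj vQ).1]
  constructor
  · rintro ⟨Φ, hΦ, rfl⟩
    rcases image_eq_or_of_actsBySigns (actsBySigns_of_mem_closure hΦ) j vQ (posK e j vQ) with h | h
    · exact Or.inl h
    · rw [h, (negSet_scHul e j vQ).1]; exact Or.inr rfl
  · rintro (rfl | rfl)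
    · exact ⟨1, (Setting.indGroup (scSituation e)).one_mem, by simp⟩
    · exact ⟨flipFamily, flipFamily_mem_indGroup_sc e, (image_posK_flipFamily e j vQ).symm⟩

/-- At the zero label the only possible image is `{0}`. [folklore] -/
theorem sc_possibleImages_zero (vQ : toyIndex.VQ) : (scSetting e).possibleImages 0 vQ = {{0}} := by
  ext U
  rw [Setting.possibleImages, sc_thetaRegion3, (regionK_zero e 1 vQ).1]
  constructor
  · rintro ⟨Φ, -, rfl⟩
    rw [Set.mem_singleton_iff, Set.image_singleton, map_zero]
  · rintro rfl
    exact ⟨1, (Setting.indGroup (scSituation e)).one_mem, by simp⟩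

/-- **The hull at a label of `𝔽_l^⋇` is the valuation ball `ballR (e j)`** — a hull-set STRICTLY larger than each possible image. [folklore] -/
theorem sc_thetaHull {j : toyIndex.Label} (hj : j ≠ 0) (vQ : toyIndex.VQ) : (scSetting e).thetaHull j vQ = ballR (e j) j vQ := by
  unfold Setting.thetaHull
  rw [sc_possibleImages e hj, Set.sUnion_insert, Set.sUnion_singleton, posK_union_negK]
  exact (scFrame e j vQ).hull_eq_self_of_mem (ballR_mem_scHul e j vQ)

/-- The hull at the zero label is `{0}`. [folklore] -/
theorem sc_thetaHull_zero (vQ : toyIndex.VQ) : (scSetting e).thetaHull 0 vQ = {0} := by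
  unfold Setting.thetaHull
  rw [sc_possibleImages_zero, Set.sUnion_singleton]
  exact (scFrame e 0 vQ).hull_eq_self_of_mem (zero_mem_scHul e 0 vQ)

/-- Every union of possible images admits its hull. [folklore] -/
theorem sc_hullDefined (j : toyIndex.Label) (vQ : toyIndex.VQ) : (scSetting e).HullDefined j vQ := ⟨trivial, trivial⟩

/-! ## 11. Volumes, the Statement (strict), `|log(q)| > 0`, the bridge hypotheses -/

/-- The local Θ-contribution at the label `j ∈ 𝔽_l^⋇` is `−e(j)` (the volume of the hull `ballR (e j)`). [folklore] -/
theorem sc_thetaLocal (i : Fin toyIndex.lstar) (vQ : toyIndex.VQ) :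
    (scSetting e).thetaLocal (Setting.labelSucc i) vQ = ((-(e (Setting.labelSucc i) : ℝ) : ℝ) : WithTop ℝ) := by
  unfold Setting.thetaLocal
  rw [if_pos (sc_hullDefined e _ vQ), sc_thetaHull e (Setting.labelSucc_ne_zero i)]
  exact congrArg _ (scVol_values e _ vQ).2.2.2.1

/-- The local q-contribution at the label `j ∈ 𝔽_l^⋇` is `−e(j) − 1` (the volume of the half `negK`). [folklore] -/
theorem sc_qLocal (i : Fin toyIndex.lstar) (vQ : toyIndex.VQ) :
    (scSetting e).qLocal (Setting.labelSucc i) vQ = -(e (Setting.labelSucc i) : ℝ) - 1 := by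
  unfold Setting.qLocal
  rw [(sc_regions_of_ne_zero e (Setting.labelSucc_ne_zero i) vQ).2]
  exact (scVol_values e _ vQ).2.2.1

/-- The Θ-pilot's OWN packet volume at `(m, j, v_ℚ)`, `j ∈ 𝔽_l^⋇`, is `−e(j) − 1` (the volume of the half `posK`) — LABEL-DEPENDENT through the
geometry of the region, at fixed normalisation. [folklore] -/
theorem sc_logvol_thetaRegion (m : ℤ) (i : Fin toyIndex.lstar) (vQ : toyIndex.VQ) :
    ((scSituation e).D (scSetting e).n).logvol _ vQ ((scSetting e).thetaRegion m (Setting.labelSucc i) vQ) =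
      -(e (Setting.labelSucc i) : ℝ) - 1 := by
  rw [sc_thetaRegion, thetaRegionK_one_of_ne_zero e (Setting.labelSucc_ne_zero i)]
  exact (scVol_values e _ vQ).2.1

/-- The hull volume is the own volume PLUS ONE at every label of `𝔽_l^⋇`: the reflection's hull gain is ADDITIVE in log-volume (a doubling of
length), whatever the size of the region. [folklore] -/
theorem sc_thetaLocal_eq_own_add_one (m : ℤ) (i : Fin toyIndex.lstar) (vQ : toyIndex.VQ) :
    (scSetting e).thetaLocal (Setting.labelSucc i) vQ =
      ((((scSituation e).D (scSetting e).n).logvol _ vQ ((scSetting e).thetaRegion m (Setting.labelSucc i) vQ) + 1 : ℝ) : WithTop ℝ) := by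
  rw [sc_thetaLocal, sc_logvol_thetaRegion]; congr 1; ring

/-- `−|log(Θ)|` is finite. [folklore] -/
theorem sc_thetaFinite : (scSetting e).ThetaFinite :=
  ⟨fun i vQ => by rw [sc_thetaLocal]; exact WithTop.coe_ne_top, fun _ => Set.toFinite _⟩

/-- `−|log(Θ)| = PN(j ↦ −e(j))`. [folklore] -/
theorem sc_negLogTheta :
    (scSetting e).negLogTheta = ((processionNormalized fun i : Fin toyIndex.lstar => -(e (Setting.labelSucc i) : ℝ) : ℝ) : WithTop ℝ) := by
  rw [(scSetting e).negLogTheta_eq_of_thetaFinite (sc_thetaFinite e)]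
  simp only [sc_thetaLocal, WithTop.untopD_coe, finsum_unique]

/-- `−|log(q)| = PN(j ↦ −e(j) − 1)`. [folklore] -/
theorem sc_negLogQ : (scSetting e).negLogQ = processionNormalized fun i : Fin toyIndex.lstar => -(e (Setting.labelSucc i) : ℝ) - 1 := by
  unfold Setting.negLogQ
  simp only [sc_qLocal, finsum_unique]

/-- `−|log(q)| = −|log(Θ)| − 1` (as real numbers; procession normalisation is additive in a constant, cf. abc-iut-rp-s2's
`ObstructionSS26.processionNormalized_add_const`, inlined here to keep the flat bed free of `Repair/` imports). [folklore] -/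
theorem sc_negLogQ_eq :
    (scSetting e).negLogQ = (processionNormalized fun i : Fin toyIndex.lstar => -(e (Setting.labelSucc i) : ℝ)) - 1 := by
  rw [sc_negLogQ]
  unfold processionNormalized
  have hl : ((toyIndex.lstar : ℕ) : ℝ) ≠ 0 := by exact_mod_cast (by decide : toyIndex.lstar ≠ 0)
  rw [Finset.sum_sub_distrib, sub_div, Finset.sum_const, Finset.card_univ, Fintype.card_fin, nsmul_eq_mul, mul_one, div_self hl]

/-- **The printed Statement of Cor. 3.12 HOLDS in P♮ˢ(e), STRICTLY: `−|log(q)| = −|log(Θ)| − 1 < −|log(Θ)|`** — the inequality comes from the hull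
of two distinct equal-volume possible images, at fixed normalisation, for every profile `e`. [folklore] -/
theorem sc_statement_strict :
    (scSetting e).Statement ∧ (((scSetting e).negLogQ : ℝ) : WithTop ℝ) < (scSetting e).negLogTheta := by
  refine ⟨((scSetting e).statement_iff_real (sc_negLogTheta e)).2 (by rw [sc_negLogQ_eq]; linarith), ?_⟩
  rw [sc_negLogTheta, sc_negLogQ_eq, WithTop.coe_lt_coe]; linarith

/-- `PN(j ↦ −e(j)) ≤ 0`. [folklore] -/
theorem sc_pn_nonpos : (processionNormalized fun i : Fin toyIndex.lstar => -(e (Setting.labelSucc i) : ℝ)) ≤ 0 := by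
  unfold processionNormalized
  refine div_nonpos_of_nonpos_of_nonneg (Finset.sum_nonpos fun i _ => ?_) (Nat.cast_nonneg _)
  have : (0 : ℝ) ≤ (e (Setting.labelSucc i) : ℝ) := Nat.cast_nonneg _
  linarith

/-- **`|log(q)| > 0`** in P♮ˢ(e) (`−|log(q)| = PN(−e) − 1 ≤ −1`). [folklore] -/
theorem sc_absLogQPos : (scSetting e).AbsLogQPos := by
  show (scSetting e).negLogQ < 0
  rw [sc_negLogQ_eq]; linarith [sc_pn_nonpos e]

/-- **All bridge hypotheses hold** (monotone volume, admissible images, nonempty hull-sets and Θ-regions, finiteness). [folklore] -/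
theorem sc_bridgeHyps : BridgeHyps (scSetting e) where
  mono := fun _ _ _ _ _ _ hAB => scVol_mono e hAB
  image_adm := fun _ _ _ _ => trivial
  image_fin := fun _ => Set.toFinite _
  hul_nonempty := fun _ _ _ hH => ⟨0, zero_mem_of_mem_scHul e hH⟩
  theta_nonempty := fun i vQ => by
    rw [(sc_regions_of_ne_zero e (Setting.labelSucc_ne_zero i) vQ).1]; exact ⟨0, zero_mem_posK e _ vQ⟩
  finite := sc_thetaFinite e

/-- Every Kummer image of the Θ-pilot is admissible. [folklore] -/
theorem sc_thetaRegionsAdm : ThetaRegionsAdm (scSetting e) := fun _ _ _ => trivial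

end NaturalScaledWitness

end Summit.ABC.IUTFork.Cor312Vol

end
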